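import Summits.PneNP.PneNP.Theorems.ExpanderLinearGeneratorsColumnTwoConn

/-!
# PneNP / ExpanderLinearGenerators — column weight two: robustness of the core under deletions

Route `PneNP/ExpanderLinearGenerators`, support for crux stmt-PneNP-11443. The Krivelevich–Sudakov
toolkit inside a core `U` whose small sets expand by the factor `1.488`
(`hX1 : W ⊆ U, 3|W| ≤ r ⟹ 186|W| ≤ 125|nbr U W|`) and all of whose halves expand by `3/(4K)`
(`hX2 : W ⊆ U, 2|W| ≤ |U| ⟹ 3|W| ≤ 4K|nbr U W|`), after deleting a row set `R ⊆ U`: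

* `exists_pruning` — a set `X ⊆ U \\ R` with `619|X| ≤ 500|R|` such that in `D = (U \\ R) \\ X` every
  `Y` with `3(|X|+|Y|) ≤ r` has `|Y| ≤ 4 |nbr D Y|`;
* `fat_ball` — consequently balls in `D` around one row reach more than `(r - 3|X|)/3` rows;
* `card_biUnion_bad_le` — the UNION LEMMA: among pairwise disjoint row sets inside `R`, those without
  a neighbour in `D` have total size `≤ 125(|R|+|X|)/311`;
* `exists_link` — the LINKING LEMMA: two connected nonempty sets of `≥ 4K|R|` rows in `U \\ R` are
  joined inside `U \\ R` by a connected set of `≤ 2(s+1)` rows, `(2K)^s |U| < (2K+1)^s`.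

References: M. Krivelevich, B. Sudakov, *Minors in expanding graphs*, GAFA 19 (2009), proof of
Theorem 4.1 / Proposition 4.3 (arXiv:0707.0133, §5) [the pruning, union and diameter arguments].
-/

namespace Summit.PneNP.PneNP.Theorems.ColumnTwo

open Finset Literature.Computability.MetaComplexity

variable {ι : Type*} [DecidableEq ι] {S : ι → Finset ℕ}

/-- Neighbours inside `U` of a set avoiding `R ⊆ U`: those inside `U \\ R` and at most `|R|` more.
[folklore] -/
theorem card_nbr_le_add {U R W : Finset ι} (hR : R ⊆ U) :
    (nbr S U W).card ≤ (nbr S (U \ R) W).card + R.card := by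
  calc (nbr S U W).card ≤ (nbr S (U \ R) W ∪ (U \ (U \ R))).card :=
        Finset.card_le_card (nbr_subset_nbr_union_sdiff (U \ R) U W)
    _ ≤ (nbr S (U \ R) W).card + (U \ (U \ R)).card := Finset.card_union_le _ _
    _ = _ := by rw [Finset.sdiff_sdiff_eq_self hR]

/-- Neighbours of a union lie in the neighbours of the parts (the second part taken in the ambient
set minus the first). [folklore] -/
theorem nbr_union_subset {V X Y : Finset ι} :
    nbr S V (X ∪ Y) ⊆ nbr S V X ∪ nbr S (V \ X) Y := by
  intro j hj
  obtain ⟨hjV, hjXY, i, hi, hij⟩ := mem_nbr.1 hj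
  rw [Finset.mem_union, not_or] at hjXY
  rcases Finset.mem_union.1 hi with hi | hi
  · exact Finset.mem_union_left _ (mem_nbr.2 ⟨hjV, hjXY.1, i, hi, hij⟩)
  · exact Finset.mem_union_right _
      (mem_nbr.2 ⟨Finset.mem_sdiff.2 ⟨hjV, hjXY.1⟩, hjXY.2, i, hi, hij⟩)

/-- **Pruning lemma.** After deleting `R ⊆ U` there is an exceptional set `X ⊆ U \\ R` with
`619 |X| ≤ 500 |R|` such that in `D = (U \\ R) \\ X` every `Y ⊆ D` with `3(|X| + |Y|) ≤ r` satisfies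
`|Y| ≤ 4 |nbr D Y|`. [cite: KrivelevichSudakov2009Minors, proof of Thm. 4.1] -/
theorem exists_pruning {U R : Finset ι} {r : ℕ}
    (hX1 : ∀ W ⊆ U, 3 * W.card ≤ r → 186 * W.card ≤ 125 * (nbr S U W).card) (hR : R ⊆ U) :
    ∃ X ⊆ U \ R, 619 * X.card ≤ 500 * R.card ∧ 3 * X.card ≤ r ∧
      ∀ Y ⊆ (U \ R) \ X, 3 * (X.card + Y.card) ≤ r → Y.card ≤ 4 * (nbr S ((U \ R) \ X) Y).card := by
  classical
  set F := (U \ R).powerset.filter fun X => 3 * X.card ≤ r ∧ 4 * (nbr S (U \ R) X).card < X.card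
    with hF
  -- the key step: a deficient `Y` inside `(U \ R) \ X` enlarges a deficient `X`
  have enlarge : ∀ X ⊆ U \ R, 4 * (nbr S (U \ R) X).card < X.card ∨ X = ∅ →
      ∀ Y ⊆ (U \ R) \ X, 3 * (X.card + Y.card) ≤ r → 4 * (nbr S ((U \ R) \ X) Y).card < Y.card →
      X ∪ Y ∈ F ∧ (X ∪ Y).card = X.card + Y.card := by
    intro X hX hXd Y hY hXY hYd
    have hdisj : Disjoint X Y := Finset.disjoint_left.2 fun a haX haY =>
      (Finset.mem_sdiff.1 (hY haY)).2 haX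
    have hcard : (X ∪ Y).card = X.card + Y.card := Finset.card_union_of_disjoint hdisj
    refine ⟨Finset.mem_filter.2 ⟨Finset.mem_powerset.2 (Finset.union_subset hX
      (hY.trans Finset.sdiff_subset)), by omega, ?_⟩, hcard⟩
    have h1 : (nbr S (U \ R) (X ∪ Y)).card ≤
        (nbr S (U \ R) X).card + (nbr S ((U \ R) \ X) Y).card :=
      (Finset.card_le_card nbr_union_subset).trans (Finset.card_union_le _ _)
    rcases hXd with hXd | rfl
    · omega
    · simp only [Finset.empty_union]
      simpa using hYd
  by_cases hne : F.Nonempty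
  · obtain ⟨X, hXF, hXmax⟩ := Finset.exists_max_image F Finset.card hne
    obtain ⟨hXsub, hX3, hXd⟩ : X ⊆ U \ R ∧ 3 * X.card ≤ r ∧ 4 * (nbr S (U \ R) X).card < X.card := by
      have := Finset.mem_filter.1 hXF
      exact ⟨Finset.mem_powerset.1 this.1, this.2.1, this.2.2⟩
    refine ⟨X, hXsub, ?_, hX3, fun Y hY hXY => ?_⟩
    · have h1 := hX1 X (hXsub.trans Finset.sdiff_subset) hX3
      have h2 := card_nbr_le_add (S := S) (W := X) hR
      omega
    · by_contra hlt
      push Not at hlt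
      obtain ⟨hmem, hcard⟩ := enlarge X hXsub (Or.inl hXd) Y hY hXY hlt
      have := hXmax _ hmem
      omega
  · refine ⟨∅, Finset.empty_subset _, by simp, by simp, fun Y hY hXY => ?_⟩
    by_contra hlt
    push Not at hlt
    exact hne ⟨_, (enlarge ∅ (Finset.empty_subset _) (Or.inr rfl) Y hY hXY hlt).1⟩

/-- **Fat balls in the pruned set.** If every `Y ⊆ D` with `3(|X| + |Y|) ≤ r` has
`|Y| ≤ 4 |nbr D Y|`, `3|X| ≤ r`, `y ∈ D` and `4^t · r < 3 · 5^t`, then the ball of radius `t`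
around `y` inside `D` has more than `(r - 3|X|)/3` rows (`3|X| ≤ r`). [folklore] -/
theorem fat_ball {D X : Finset ι} {r t : ℕ}
    (hD : ∀ Y ⊆ D, 3 * (X.card + Y.card) ≤ r → Y.card ≤ 4 * (nbr S D Y).card)
    (hX3 : 3 * X.card ≤ r) {y : ι} (hy : y ∈ D) (ht : 4 ^ t * r < 3 * 5 ^ t) :
    (r - 3 * X.card) / 3 < (ball S D {y} t).card := by
  have hgrow : ∀ Y, {y} ⊆ Y → Y ⊆ D → Y.card ≤ (r - 3 * X.card) / 3 →
      1 * Y.card ≤ 4 * (nbr S D Y).card := by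
    intro Y _ hYD hYM
    rw [one_mul]
    refine hD Y hYD ?_
    have := Nat.div_mul_le_self (r - 3 * X.card) 3
    omega
  rcases le_card_ball_of_growth hgrow (Finset.singleton_subset_iff.2 hy) t with h | h
  · exact h
  · by_contra hle
    push Not at hle
    rw [Finset.card_singleton, mul_one, show (4 : ℕ) + 1 = 5 by rfl] at h
    have h1 : 4 ^ t * (ball S D {y} t).card ≤ 4 ^ t * ((r - 3 * X.card) / 3) :=
      Nat.mul_le_mul_left _ hle
    have h2 : 4 ^ t * ((r - 3 * X.card) / 3) * 3 ≤ 4 ^ t * r := by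
      rw [mul_assoc]
      exact Nat.mul_le_mul_left _ ((Nat.div_mul_le_self _ 3).trans (Nat.sub_le _ _))
    omega

/-- **Union lemma** (Krivelevich–Sudakov): let `B j ⊆ R`, `j ∈ J`, be pairwise disjoint row sets
and call `j` BAD when `B j` has no neighbour (inside `U`) in `D = (U \\ R) \\ X`. If `3|R| ≤ r` then
the bad sets have total size `Z` with `311 Z ≤ 125 (|R| + |X|)`.
[cite: KrivelevichSudakov2009Minors, proof of Thm. 4.1] -/
theorem card_biUnion_bad_le {κ : Type*} {U R X : Finset ι} {r : ℕ}
    (hX1 : ∀ W ⊆ U, 3 * W.card ≤ r → 186 * W.card ≤ 125 * (nbr S U W).card)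
    (hR : R ⊆ U) (hRr : 3 * R.card ≤ r) (J : Finset κ) (B : κ → Finset ι) (hB : ∀ j ∈ J, B j ⊆ R)
    (hbad : ∀ j ∈ J, ∀ y ∈ nbr S U (B j), y ∉ (U \ R) \ X) :
    311 * (J.biUnion B).card ≤ 125 * (R.card + X.card) := by
  set Z := J.biUnion B with hZ
  have hZR : Z ⊆ R := Finset.biUnion_subset.2 hB
  have h1 := hX1 Z (hZR.trans hR) ((Nat.mul_le_mul_left 3 (Finset.card_le_card hZR)).trans hRr)
  -- neighbours of `Z` lie in `R \ Z` or in `X`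
  have h2 : nbr S U Z ⊆ (R \ Z) ∪ X := by
    intro y hy
    obtain ⟨hyU, hyZ, i, hi, hiy⟩ := mem_nbr.1 hy
    obtain ⟨j, hj, hij⟩ := Finset.mem_biUnion.1 hi
    have hy' : y ∈ nbr S U (B j) := mem_nbr.2 ⟨hyU, fun h => hyZ (Finset.mem_biUnion.2 ⟨j, hj, h⟩),
      i, hij, hiy⟩
    have := hbad j hj y hy'
    rw [Finset.mem_sdiff, Finset.mem_sdiff, not_and, not_not] at this
    by_cases hyR : y ∈ R
    · exact Finset.mem_union_left _ (Finset.mem_sdiff.2 ⟨hyR, hyZ⟩)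
    · exact Finset.mem_union_right _ (this ⟨hyU, hyR⟩)
  have h3 : (nbr S U Z).card ≤ R.card - Z.card + X.card := by
    calc (nbr S U Z).card ≤ ((R \ Z) ∪ X).card := Finset.card_le_card h2
      _ ≤ (R \ Z).card + X.card := Finset.card_union_le _ _
      _ = _ := by rw [Finset.card_sdiff_of_subset hZR]
  have h4 : Z.card ≤ R.card := Finset.card_le_card hZR
  omega

/-- **Linking lemma** (Krivelevich–Sudakov's diameter argument, robust form). In a core `U` all
of whose halves expand by `3/(4K)` (`K ≥ 1`), delete `R ⊆ U`; two connected nonempty row sets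
`F₁, F₂ ⊆ U \\ R` of size `≥ 4K|R|` each are joined inside `U \\ R` by a connected set of at most
`2(s+1)` rows meeting both, as soon as `(2K)^s |U| < (2K+1)^s`.
[cite: KrivelevichSudakov2009Minors, Lemma 5.1] -/
theorem exists_link {U R F₁ F₂ : Finset ι} {K s : ℕ}
    (hX2 : ∀ W ⊆ U, 2 * W.card ≤ U.card → 3 * W.card ≤ 4 * K * (nbr S U W).card)
    (hR : R ⊆ U) (hF₁ : F₁ ⊆ U \ R) (hF₂ : F₂ ⊆ U \ R) (hne₁ : F₁.Nonempty) (hne₂ : F₂.Nonempty)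
    (hfat₁ : 4 * K * R.card ≤ F₁.card) (hfat₂ : 4 * K * R.card ≤ F₂.card)
    (hs : (2 * K) ^ s * U.card < (2 * K + 1) ^ s) :
    ∃ P ⊆ U \ R, IsConn S P ∧ (P ∩ F₁).Nonempty ∧ (P ∩ F₂).Nonempty ∧ P.card ≤ 2 * (s + 1) := by
  -- large balls around fat sets inside `U \ R`
  have big : ∀ F ⊆ U \ R, F.Nonempty → 4 * K * R.card ≤ F.card →
      U.card / 2 < (ball S (U \ R) F s).card := by
    intro F hF hFne hfat
    have hgrow : ∀ Y, F ⊆ Y → Y ⊆ U \ R → Y.card ≤ U.card / 2 →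
        1 * Y.card ≤ 2 * K * (nbr S (U \ R) Y).card := by
      intro Y hFY hY hYM
      have h1 := hX2 Y (hY.trans Finset.sdiff_subset) (by omega)
      have h2 := card_nbr_le_add (S := S) (W := Y) hR
      have h3 : F.card ≤ Y.card := Finset.card_le_card hFY
      nlinarith
    rcases le_card_ball_of_growth hgrow hF s with h | h
    · exact h
    · exfalso
      have h1 : 1 ≤ F.card := Finset.card_pos.2 hFne
      have h2 : (ball S (U \ R) F s).card ≤ U.card :=
        Finset.card_le_card ((ball_subset hF s).trans Finset.sdiff_subset)
      have h3 : (2 * K + 1) ^ s ≤ (2 * K) ^ s * U.card :=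
        calc (2 * K + 1) ^ s ≤ (2 * K + 1) ^ s * F.card := Nat.le_mul_of_pos_right _ h1
          _ ≤ (2 * K) ^ s * (ball S (U \ R) F s).card := h
          _ ≤ _ := Nat.mul_le_mul_left _ h2
      omega
  have hb₁ := big F₁ hF₁ hne₁ hfat₁
  have hb₂ := big F₂ hF₂ hne₂ hfat₂
  -- the two balls meet
  have hmeet : (ball S (U \ R) F₁ s ∩ ball S (U \ R) F₂ s).Nonempty := by
    rw [← Finset.card_pos]
    have h1 := Finset.card_union_add_card_inter (ball S (U \ R) F₁ s) (ball S (U \ R) F₂ s)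
    have h2 : (ball S (U \ R) F₁ s ∪ ball S (U \ R) F₂ s).card ≤ U.card :=
      Finset.card_le_card (Finset.union_subset ((ball_subset hF₁ s).trans Finset.sdiff_subset)
        ((ball_subset hF₂ s).trans Finset.sdiff_subset))
    omega
  obtain ⟨z, hz⟩ := hmeet
  rw [Finset.mem_inter] at hz
  obtain ⟨Q₁, hQ₁, hc₁, hz₁, hQF₁, hcard₁⟩ := exists_geodesic hz.1
  obtain ⟨Q₂, hQ₂, hc₂, hz₂, hQF₂, hcard₂⟩ := exists_geodesic hz.2
  refine ⟨Q₁ ∪ Q₂, Finset.union_subset (hQ₁.trans (ball_subset hF₁ s))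
    (hQ₂.trans (ball_subset hF₂ s)), hc₁.union hc₂ (Or.inr ⟨z, Finset.mem_inter.2 ⟨hz₁, hz₂⟩⟩),
    hQF₁.mono (Finset.inter_subset_inter_right Finset.subset_union_left),
    hQF₂.mono (Finset.inter_subset_inter_right Finset.subset_union_right), ?_⟩
  exact (Finset.card_union_le _ _).trans (by omega)

end Summit.PneNP.PneNP.Theorems.ColumnTwo

/-!
# PneNP / ExpanderLinearGenerators — column weight two: many disjoint connected branch sets

Route `PneNP/ExpanderLinearGenerators`, support for crux stmt-PneNP-11443. Inside a core `U` whose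
small sets expand (`hX1`), one can pick `p` pairwise disjoint connected row sets of exactly `q` rows
each (`3(p+1)q ≤ r`): delete the sets found so far, prune (`exists_pruning`), grow a fat ball in
the pruned set (`fat_ball`) and trim its last layer to the right size.

* `exists_conn_card_eq` — a ball with `≥ q` rows contains a connected set of exactly `q` rows;
* `exists_branch_family` — `p` pairwise disjoint connected `q`-subsets of `U`.

[folklore; cf. Krivelevich–Sudakov, GAFA 19 (2009), proof of Prop. 4.3]
-/

namespace Summit.PneNP.PneNP.Theorems.ColumnTwo

open Finset Literature.Computability.MetaComplexity

variable {ι : Type*} [DecidableEq ι] {S : ι → Finset ℕ}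

/-- **Trimming a ball**: if the ball of radius `t` around `y` inside `V` has at least `q ≥ 1` rows,
it contains a connected set of exactly `q` rows containing `y`. [folklore] -/
theorem exists_conn_card_eq {V : Finset ι} {y : ι} {q t : ℕ} (hq : 1 ≤ q)
    (ht : q ≤ (ball S V {y} t).card) :
    ∃ B ⊆ ball S V {y} t, IsConn S B ∧ B.card = q ∧ y ∈ B := by
  classical
  have hex : ∃ t', q ≤ (ball S V {y} t').card := ⟨t, ht⟩
  have hspec := Nat.find_spec hex
  have hle : Nat.find hex ≤ t := Nat.find_min' hex ht
  rcases h0 : Nat.find hex with _ | t₁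
  · rw [h0, ball_zero, Finset.card_singleton] at hspec
    refine ⟨{y}, ?_, isConn_singleton y, by simp; omega, Finset.mem_singleton_self y⟩
    exact Finset.singleton_subset_iff.2 (subset_ball V {y} t (Finset.mem_singleton_self y))
  · rw [h0] at hspec hle
    have hlt : (ball S V {y} t₁).card < q := by
      have := Nat.find_min hex (show t₁ < Nat.find hex by omega)
      omega
    rw [card_ball_succ] at hspec
    obtain ⟨N', hN', hcard⟩ := Finset.exists_subset_card_eq
      (show q - (ball S V {y} t₁).card ≤ (nbr S V (ball S V {y} t₁)).card by omega)
    refine ⟨ball S V {y} t₁ ∪ N', ?_, ?_, ?_, ?_⟩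
    · refine le_trans ?_ (ball_mono hle)
      rw [ball_succ]
      exact Finset.union_subset_union (Finset.Subset.refl _) hN'
    · exact (isConn_ball (isConn_singleton y) t₁).union_nbrs fun n hn => (mem_nbr.1 (hN' hn)).2.2
    · rw [Finset.card_union_of_disjoint, hcard]
      · omega
      · exact Finset.disjoint_left.2 fun j hj hj' => (mem_nbr.1 (hN' hj')).2.1 hj
    · exact Finset.mem_union_left _ (subset_ball V {y} t₁ (Finset.mem_singleton_self y))

/-- **Branch sets.** In a core `U` with `|U| > r` whose small sets expand
(`hX1 : W ⊆ U, 3|W| ≤ r ⟹ 186|W| ≤ 125|nbr U W|`), for `q ≥ 1`, `3(p+1)q ≤ r` and a radius `t` with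
`4^t r < 3 · 5^t`, there are `p` pairwise disjoint connected sets of exactly `q` rows of `U`.
[folklore] -/
theorem exists_branch_family {U : Finset ι} {r p q t : ℕ}
    (hX1 : ∀ W ⊆ U, 3 * W.card ≤ r → 186 * W.card ≤ 125 * (nbr S U W).card)
    (hUr : r < U.card) (hq : 1 ≤ q) (hpq : 3 * (p + 1) * q ≤ r) (ht : 4 ^ t * r < 3 * 5 ^ t) :
    ∃ F : Finset (Finset ι), F.card = p ∧ (∀ B ∈ F, B ⊆ U ∧ IsConn S B ∧ B.card = q) ∧
      ∀ B ∈ F, ∀ B' ∈ F, B ≠ B' → Disjoint B B' := by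
  classical
  induction p with
  | zero => exact ⟨∅, by simp, by simp, by simp⟩
  | succ p ih =>
    obtain ⟨F, hFc, hFm, hFd⟩ := ih (le_trans (by nlinarith) hpq)
    set R := F.biUnion id with hR
    have hRU : R ⊆ U := Finset.biUnion_subset.2 fun B hB => (hFm B hB).1
    have hRcard : R.card ≤ p * q := by
      calc R.card ≤ ∑ B ∈ F, (id B).card := Finset.card_biUnion_le
        _ = ∑ B ∈ F, q := Finset.sum_congr rfl fun B hB => (hFm B hB).2.2
        _ = p * q := by rw [Finset.sum_const, smul_eq_mul, hFc]
    obtain ⟨X, hX, hXR, hX3, hD⟩ := exists_pruning hX1 hRU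
    set D := (U \ R) \ X with hDdef
    -- `D` is nonempty
    have hDne : D.Nonempty := by
      rw [← Finset.card_pos, hDdef, Finset.card_sdiff_of_subset hX, Finset.card_sdiff_of_subset hRU]
      have h1 : X.card ≤ R.card := by omega
      have h2 : 2 * (p * q) < U.card := by nlinarith
      omega
    obtain ⟨y, hy⟩ := hDne
    have hfat := fat_ball hD hX3 hy ht
    have hqball : q ≤ (ball S D {y} t).card := by
      have h1 : X.card ≤ p * q := by omega
      have h2 : q ≤ (r - 3 * X.card) / 3 + 1 := by
        have : 3 * q + 3 * X.card ≤ r + 3 := by nlinarith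
        omega
      omega
    obtain ⟨B, hB, hBc, hBcard, -⟩ := exists_conn_card_eq (S := S) hq hqball
    have hBD : B ⊆ D := hB.trans (ball_subset (Finset.singleton_subset_iff.2 hy) t)
    have hBU : B ⊆ U := hBD.trans (Finset.sdiff_subset.trans Finset.sdiff_subset)
    have hBR : Disjoint B R := Finset.disjoint_left.2 fun j hjB hjR =>
      (Finset.mem_sdiff.1 (Finset.mem_sdiff.1 (hBD hjB)).1).2 hjR
    have hBdisj : ∀ B' ∈ F, Disjoint B B' := fun B' hB' =>
      hBR.mono_right (Finset.subset_biUnion_of_mem id hB')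
    have hBnot : B ∉ F := fun h => by
      have hBne : B.Nonempty := Finset.card_pos.1 (by omega)
      obtain ⟨j, hj⟩ := hBne
      exact Finset.disjoint_left.1 (hBdisj B h) hj hj
    refine ⟨insert B F, by rw [Finset.card_insert_of_notMem hBnot, hFc], ?_, ?_⟩
    · intro B' hB'
      rcases Finset.mem_insert.1 hB' with rfl | hB'
      · exact ⟨hBU, hBc, hBcard⟩
      · exact hFm B' hB'
    · intro B₁ h₁ B₂ h₂ hne
      rw [Finset.mem_insert] at h₁ h₂
      rcases h₁ with rfl | h₁
      · rcases h₂ with rfl | h₂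
        · exact absurd rfl hne
        · exact hBdisj B₂ h₂
      · rcases h₂ with rfl | h₂
        · exact (hBdisj B₁ h₁).symm
        · exact hFd B₁ h₁ B₂ h₂ hne

end Summit.PneNP.PneNP.Theorems.ColumnTwo
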